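import Summits.ResolutionOfSingularities.ResolutionOfSingularities.Theorems.TightCutPoverty
import Summits.ResolutionOfSingularities.ResolutionOfSingularities.Theorems.TightCutClasses
import HarnessLib

/-!
# MaxContactCutTightCut — decomp-res node «TightCut» (lens-3 g17), tree file 7/7 (Theses cone): §K3 BOOKING —
WINDOW `s = 3` (`q ≥ 7`) DECIDED
(`noShadeThreeJointTails_holds`), the joint residual of aside 31770 RE-LOCATED at shade `≥ 4` or `q = 4` EXACTLY
(`three_iff_four`, `joint_iff_four`,
`defectWalksDeep_iff_four`, hypothesis-free; 31770 BY NAME `defectWalksDeep_of_four`; necessity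
`four_of_defectWalksDeep`); §L4 lens-3 letters one
window further (`NoMixedTailsFromFourDeep`, `NoTameMixedTailsFromFourDeep`, EXACT `mixed_iff_fromFour` /
`tameMixed_iff_fromFour`); §N ONE
CONJUNCTION CLASS WITH LENS-5 (`NoNonPlanarJointTailsFromFourDeep`; EXACT `four_iff_nonPlanarFour`, `joint_iff_nonPlanarFour`,
`nonPlanar_iff_nonPlanarFour`, `defectWalksDeep_iff_nonPlanarFour`, via the tree's `PlanarCut.joint_iff_nonPlanar`).
 ONE aside is booked from this
node: `NoJointTailsFromFourDeep` (home `TightCutClasses`), superseding g16's `ShadeCut.NoJointTailsFromThreeDeep`.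

Content VERBATIM from the decomp-res lens-3 g17 file `HOME/decomp-res-lens-3/g17/TightCut.lean` (sha256
7fe2fb69bd2eaf82, 3149 l;
HOME = run/shared/lean/pub/decomp-res).  Critic: CRITIC-LEDGER row 136 CLEARED, landing order 2026-08-30T19:49:35Z
(after node «ShadeCut» =
`Theorems/ShadeCutLawJ`, `ShadeCutTailTwo`, `ShadeCutShadeTwo`, `MaxContactCutShadeCut`).

[WRITER NOTE (decomp-res writer g7): the lens's carried VERBATIM copies §V1/§V2 (g15 ConeCut calculus),
§J/§S/§K/§L/§M (g16 ShadeCut) are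
DELETED in favour of the landed `Theorems/ConeCut*`, `ConeCutAxisLaw`, `FloorCutFloor`, `ShadeCut*`,
`MaxContactCutShadeCut` (imported and
opened; `exists_third`/`exists_ne` now the tree's `ConeCut.exists_third` / `FloorCut.exists_ne`); the by-name
`closes` re-export (§M) is not
restated; g16's `fin3_enum` (dedup of a Literature triviality) becomes a proof-local `have … := by decide` in `prod_three`.  NEW content only, split by the lens's own sections (400-line file limit): `TightCutLawJ2` (§J₂.1–§J₂.3), `TightCutWitness`
(§J₂.4–§J₂.5), `TightCutCharts` + `TightCutCharts2` (§J₂.6), `TightCutPoverty` (§P), `TightCutClasses`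
(cone-free: the two §K3 classes, home of
the aside), `MaxContactCutTightCut` (Theses cone: §K3 theorems + §L4 + §N).  ONE namespace `…Theorems.TightCut`
as in the lens; global
`set_option` line dropped; nothing else changed.]
(Sources: CossartPiltant2008 Prop. 4.2; CossartPiltant2009; CossartJannsenSaito2020; Hauser2010; Moh1987;
HauserPerlega2019; BenitoVillamayor2012; Cutkosky2009 Thm. 5.1.)
-/

noncomputable section

open MvPolynomial Finset
open Literature.AlgebraicGeometry.Resolution
open Literature.AlgebraicGeometry.Resolution.Hauser2010
open Literature.AlgebraicGeometry.Resolution.PointBlowup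
open Summit.ResolutionOfSingularities.ResolutionOfSingularities.Theses
open Summit.ResolutionOfSingularities.ResolutionOfSingularities.Theorems.TightDefectClasses
open Summit.ResolutionOfSingularities.ResolutionOfSingularities.Theorems.TightDefectStrongWalks
open Summit.ResolutionOfSingularities.ResolutionOfSingularities.Theorems.ItineraryCutClasses
open Summit.ResolutionOfSingularities.ResolutionOfSingularities.Theorems.BoundaryLedger
open Summit.ResolutionOfSingularities.ResolutionOfSingularities.Theorems.ProximityCut
open Summit.ResolutionOfSingularities.ResolutionOfSingularities.Theorems.ConeCutAxisLaw
open Literature.AlgebraicGeometry.Resolution.WeightedBlowup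
open Literature.Barriers.ResolutionOfSingularities
open Summit.ResolutionOfSingularities.ResolutionOfSingularities.Theorems.FloorCut
open Summit.ResolutionOfSingularities.ResolutionOfSingularities.Theorems.ConeCut
open Summit.ResolutionOfSingularities.ResolutionOfSingularities.Theorems.ExitLaw (fin3_cases)
open Summit.ResolutionOfSingularities.ResolutionOfSingularities.Theorems.ShadeCut

namespace Summit.ResolutionOfSingularities.ResolutionOfSingularities.Theorems.TightCut

/-! ### §K3 (g17) — the shade axis one window further: WINDOW `s = 3` (`q ≥ 7`) DECIDED, residual RE-LOCATED at
`s ≥ 4` (plus the single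
tiny modulus `q = 4`), EXACT.  (Classes `NoShadeThreeJointTailsDeep`, `NoJointTailsFromFourDeep`: `TightCutClasses`.) -/

/-- **THE SHADE-THREE WINDOW IS EMPTY (PROVED).** [new] [folklore] -/
theorem noShadeThreeJointTails_holds : NoShadeThreeJointTailsDeep := by
  intro p hp e he K _ _ _ _ s₀ hs W _ N hN hex hrec htr h3 h7
  exact TailThree.shadeThree_tail_false hs h7 ⟨hN, h3, hex⟩ hrec htr

/-- Necessity of the window (by letter). [folklore] -/
theorem shadeThree_of_three (h : NoJointTailsFromThreeDeep) : NoShadeThreeJointTailsDeep :=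
  fun p hp e he K _ _ _ _ s₀ hs W hW N hN hex hrec htr h3 _ =>
    h p hp e he K s₀ hs W hW N hN hex hrec htr (by rw [h3])

/-- Necessity of the located residual (by letter). [folklore] -/
theorem four_of_three (h : NoJointTailsFromThreeDeep) : NoJointTailsFromFourDeep := by
  intro p hp e he K _ _ _ _ s₀ hs W hW N hN hex hrec htr h4
  classical
  obtain ⟨o, ho, -⟩ := walk_nat hs W N
  obtain ⟨s, hsN, -⟩ := order_eq_shade_add_degree hs W N ho
  have h1 := hW N
  rw [hsN] at h1
  have hs1 : 1 ≤ s := by exact_mod_cast h1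
  rcases (show s = 1 ∨ s = 2 ∨ 3 ≤ s by omega) with h' | h' | h'
  · subst h'
    refine FloorCut.noHighPlateaux_shade_one hs W (N := N) (fun t ht => ⟨shade_of_plateau W hN hsN t ht, ?_⟩) htr
    obtain ⟨o', ho', hqo'⟩ := walk_nat hs W t
    have hne := hex t ht
    rw [ho'] at hne ⊢
    have hne' : o' ≠ p ^ e := by
      intro h''
      apply hne
      rw [h'']
    exact_mod_cast lt_of_le_of_ne hqo' (Ne.symm hne')
  · subst h'
    exact noShadeTwoJointTails_holds p hp e he K s₀ hs W hW N hN hex hrec htr hsN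
  · exact h p hp e he K s₀ hs W hW N hN hex hrec htr (by rw [hsN]; exact_mod_cast h')

/-- **SUFFICIENCY (PROVED)**: the residual at shades `≥ 4` (or `q = 4`) gives back the shade-`≥ 3` residual — the
shade-`3` slice with `q ≥ 7` is the shade-three theorem. [new] [folklore] -/
theorem three_of_four (h : NoJointTailsFromFourDeep) : NoJointTailsFromThreeDeep := by
  intro p hp e he K _ _ _ _ s₀ hs W hW N hN hex hrec htr h3
  classical
  obtain ⟨o, ho, -⟩ := walk_nat hs W N
  obtain ⟨s, hsN, -⟩ := order_eq_shade_add_degree hs W N ho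
  rw [hsN] at h3
  have hs3 : 3 ≤ s := by exact_mod_cast h3
  by_cases h4 : 4 ≤ s
  · exact h p hp e he K s₀ hs W hW N hN hex hrec htr (Or.inl (by rw [hsN]; exact_mod_cast h4))
  · have hs' : s = 3 := by omega
    subst hs'
    by_cases h7 : 7 ≤ p ^ e
    · exact noShadeThreeJointTails_holds p hp e he K s₀ hs W hW N hN hex hrec htr hsN h7
    · exact h p hp e he K s₀ hs W hW N hN hex hrec htr (Or.inr (by omega))

/-- **THE ONE CERTIFIED EQUIVALENCE OF THIS NODE (PROVED, EXACT)**: g16's located residual IS its slice at shades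
`≥ 4` (plus the tiny modulus `q = 4`). [new] [folklore] -/
theorem three_iff_four : NoJointTailsFromThreeDeep ↔ NoJointTailsFromFourDeep :=
  ⟨four_of_three, three_of_four⟩

/-- **EXACT, composed with g16**: the tree's joint residual IS the shade-`≥ 4` (or `q = 4`) residual. [new] [folklore] -/
theorem joint_iff_four : ExitLaw.NoRepeatTranslationRecurrentExcessPlateauxDeep ↔ NoJointTailsFromFourDeep :=
  joint_iff_three.trans three_iff_four

/-- **KERNEL BY NAME (aside 31770)**: deep arc law ∧ the shade-`≥ 4` residual ⇒
`MaxContactCut.DefectWalksDeep`. [new] [folklore] -/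
theorem defectWalksDeep_of_four (hA : NoFreePointTailsDeep) (hR : NoJointTailsFromFourDeep) :
    MaxContactCut.DefectWalksDeep :=
  defectWalksDeep_of_three hA (three_of_four hR)

/-- **THE EXACT CUT OF 31770 AFTER g17 (PROVED, hypothesis-free)**:
`MaxContactCut.DefectWalksDeep ↔ deep arc law ∧ joint tails of shade ≥ 4 (or q = 4)`. [new] [folklore] -/
theorem defectWalksDeep_iff_four :
    MaxContactCut.DefectWalksDeep ↔ NoFreePointTailsDeep ∧ NoJointTailsFromFourDeep := by
  rw [defectWalksDeep_iff_three, three_iff_four]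

/-- Necessity of the located residual for 31770. [folklore] -/
theorem four_of_defectWalksDeep (h : MaxContactCut.DefectWalksDeep) : NoJointTailsFromFourDeep :=
  (defectWalksDeep_iff_four.mp h).2

/-! ### §L4 (g17) — the lens-3 vocabulary one window further. -/

/-- PIECE (lens-3 vocabulary) · MIXED TAILS OF SHADE AT LEAST FOUR, OR OF THE TINY MODULUS `q < 7` —
`NoMixedTailsFromThreeDeep` plus the clause `4 ≤ s ∨ p^e < 7` (binders otherwise VERBATIM) · EXACT
(`mixedThree_iff_fromFour`) · UNDECIDED. -/
def NoMixedTailsFromFourDeep : Prop :=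
  ∀ p : ℕ, p.Prime → ∀ e : ℕ, 2 ≤ e → ∀ (K : Type) [Field K] [CharP K p] [PerfectField K] [DecidableEq K]
    (s₀ : State (Fin 3) K), IsRoot (p ^ e) s₀ → ∀ W : ForcedWalk (p ^ e) s₀,
    ∀ N s : ℕ, 3 ≤ s → s < p ^ e → (4 ≤ s ∨ p ^ e < 7) →
    (∀ t, N ≤ t → (W.st t).shade = (s : ℕ∞) ∧ ((p ^ e : ℕ) : ℕ∞) < ordZero (W.st t).F) →
    (∀ M : ℕ, ∃ i, M ≤ i ∧ W.b i ≠ 0) →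
    (∀ M : ℕ, ∃ t, M ≤ t ∧ StaysOnNewest W t) → (∀ M : ℕ, ∃ t, M ≤ t ∧ LeavesNewest W t) → False

/-- PIECE (lens-3 vocabulary) · THE LOCATED RESIDUAL OF g15 AFTER g17 — TAME MIXED TAILS OF SHADE AT LEAST FOUR, OR
OF THE TINY MODULUS `q < 7` (`NoTameMixedTailsFromThreeDeep` plus `4 ≤ s ∨ p^e < 7`) · EXACT
(`tameMixedThree_iff_fromFour`) · UNDECIDED. -/
def NoTameMixedTailsFromFourDeep : Prop :=
  ∀ p : ℕ, p.Prime → ∀ e : ℕ, 2 ≤ e → ∀ (K : Type) [Field K] [CharP K p] [PerfectField K] [DecidableEq K]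
    (s₀ : State (Fin 3) K), IsRoot (p ^ e) s₀ → ∀ W : ForcedWalk (p ^ e) s₀,
    ∀ N s : ℕ, 3 ≤ s → s < p ^ e → (4 ≤ s ∨ p ^ e < 7) →
    (∀ t, N ≤ t → (W.st t).shade = (s : ℕ∞) ∧ ((p ^ e : ℕ) : ℕ∞) < ordZero (W.st t).F) →
    (∀ M : ℕ, ∃ i, M ≤ i ∧ W.b i ≠ 0) →
    (∀ M : ℕ, ∃ t, M ≤ t ∧ StaysOnNewest W t) → (∀ M : ℕ, ∃ t, M ≤ t ∧ LeavesNewest W t) →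
    IsTameFrom W N → False

/-- **THE SHADE-THREE SLICE OF THE MIXED RESIDUAL IS EMPTY for `q ≥ 7` (PROVED)** — neither tameness nor the
newest-free letter is used. [new] [folklore] -/
theorem noMixedTails_shadeThree {p e : ℕ} (h7 : 7 ≤ p ^ e) {K : Type} [Field K] [DecidableEq K]
    {s₀ : State (Fin 3) K} (hs : IsRoot (p ^ e) s₀) (W : ForcedWalk (p ^ e) s₀) (N : ℕ)
    (hplat : ∀ t, N ≤ t → (W.st t).shade = ((3 : ℕ) : ℕ∞) ∧ ((p ^ e : ℕ) : ℕ∞) < ordZero (W.st t).F)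
    (htr : ∀ M : ℕ, ∃ i, M ≤ i ∧ W.b i ≠ 0) (hR : ∀ M : ℕ, ∃ t, M ≤ t ∧ StaysOnNewest W t) : False :=
  TailThree.shadeThree_tail_false hs h7
    ⟨fun t ht => by rw [(hplat (t + 1) (by omega)).1, (hplat t ht).1], (hplat N le_rfl).1,
      fun t ht => (hplat t ht).2.ne'⟩ hR htr

/-- **EXACT**: `NoMixedTailsFromThreeDeep ↔ NoMixedTailsFromFourDeep`. [new] [folklore] -/
theorem mixedThree_iff_fromFour : NoMixedTailsFromThreeDeep ↔ NoMixedTailsFromFourDeep := by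
  refine ⟨fun h p hp e he K _ _ _ _ s₀ hs W N s h3 hsq _ hplat htr hR hF =>
    h p hp e he K s₀ hs W N s h3 hsq hplat htr hR hF, fun h => ?_⟩
  intro p hp e he K _ _ _ _ s₀ hs W N s h3 hsq hplat htr hR hF
  by_cases h4 : 4 ≤ s ∨ p ^ e < 7
  · exact h p hp e he K s₀ hs W N s h3 hsq h4 hplat htr hR hF
  · have h3' : s = 3 := by omega
    subst h3'
    exact noMixedTails_shadeThree (by omega) hs W N hplat htr hR

/-- **EXACT**: `NoTameMixedTailsFromThreeDeep ↔ NoTameMixedTailsFromFourDeep`. [new] [folklore] -/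
theorem tameMixedThree_iff_fromFour : NoTameMixedTailsFromThreeDeep ↔ NoTameMixedTailsFromFourDeep := by
  refine ⟨fun h p hp e he K _ _ _ _ s₀ hs W N s h3 hsq _ hplat htr hR hF hT =>
    h p hp e he K s₀ hs W N s h3 hsq hplat htr hR hF hT, fun h => ?_⟩
  intro p hp e he K _ _ _ _ s₀ hs W N s h3 hsq hplat htr hR hF hT
  by_cases h4 : 4 ≤ s ∨ p ^ e < 7
  · exact h p hp e he K s₀ hs W N s h3 hsq h4 hplat htr hR hF hT
  · have h3' : s = 3 := by omega
    subst h3'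
    exact noMixedTails_shadeThree (by omega) hs W N hplat htr hR

/-- **EXACT, composed with g16**: `NoMixedTailsDeep ↔ NoMixedTailsFromFourDeep`. [new] [folklore] -/
theorem mixed_iff_fromFour : NoMixedTailsDeep ↔ NoMixedTailsFromFourDeep :=
  mixed_iff_fromThree.trans mixedThree_iff_fromFour

/-- **EXACT, composed with g16**: g15's located residual IS its slice at shades `≥ 4` (or `q = 4`):
`NoTameMixedTailsDeep ↔ NoTameMixedTailsFromFourDeep`. [new] [folklore] -/
theorem tameMixed_iff_fromFour : NoTameMixedTailsDeep ↔ NoTameMixedTailsFromFourDeep :=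
  tameMixed_iff_fromThree.trans tameMixedThree_iff_fromFour

/-! ## §N ONE CONJUNCTION CLASS WITH LENS-5 (critic row 130; bookkeeping, no new mathematics): the joint residual
≡ joint tails that are BOTH of shade `≥ 4` (or `q = 4`) AND run along no wall — composing `joint_iff_four` with the
tree's `PlanarCut.joint_iff_nonPlanar` (`Theorems/MaxContactCutPlanarCut.lean`, lens-5 g18 rev 1, landed; its
per-walk kernel `PlanarCut.noPlanarTails`). -/

section WithLens5

/-- ONE CONJUNCTION CLASS · binders of the tree's joint residual VERBATIM + the shade clause of
`NoJointTailsFromFourDeep` + the non-planar letter of the tree's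
`PlanarCut.NoNonPlanarRepeatTranslationRecurrentExcessPlateauxDeep` (a wall never used as chart and never translated
along from some step on carries no boundary mass there) · WEAKER than each by letter · EXACT (`four_iff_nonPlanarFour`,
`joint_iff_nonPlanarFour`, `nonPlanar_iff_nonPlanarFour`) · UNDECIDED. -/
def NoNonPlanarJointTailsFromFourDeep : Prop :=
  ∀ p : ℕ, p.Prime → ∀ e : ℕ, 2 ≤ e → ∀ (K : Type) [Field K] [CharP K p] [PerfectField K] [DecidableEq K]
    (s₀ : State (Fin 3) K), IsRoot (p ^ e) s₀ → ∀ W : ForcedWalk (p ^ e) s₀, (∀ i, 1 ≤ (W.st i).shade) →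
    ∀ N : ℕ, (∀ t, N ≤ t → (W.st (t + 1)).shade = (W.st t).shade) →
    (∀ t, N ≤ t → ordZero (W.st t).F ≠ ((p ^ e : ℕ) : ℕ∞)) → (∀ M : ℕ, ∃ t, M ≤ t ∧ StaysOnNewest W t) →
    (∀ M : ℕ, ∃ t, M ≤ t ∧ W.b t ≠ 0) → (((4 : ℕ) : ℕ∞) ≤ (W.st N).shade ∨ p ^ e < 7) →
    (∀ (k : Fin 3) (N' : ℕ), (∀ t, N' ≤ t → W.j t ≠ k ∧ W.b t k = 0) → (W.st N').r k = 0) → False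

/-- Necessity (by letter). [folklore] -/
theorem nonPlanarFour_of_four (h : NoJointTailsFromFourDeep) : NoNonPlanarJointTailsFromFourDeep :=
  fun p hp e he K _ _ _ _ s₀ hs W hW N hN hex hrec htr h4 _ => h p hp e he K s₀ hs W hW N hN hex hrec htr h4

/-- **SUFFICIENCY (PROVED)**: a wall carrying boundary mass along a planar tail is lens-5's theorem
`PlanarCut.noPlanarTails`; otherwise the non-planar letter holds and the conjunction class applies. [new] [folklore] -/
theorem four_of_nonPlanarFour (h : NoNonPlanarJointTailsFromFourDeep) : NoJointTailsFromFourDeep := by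
  intro p hp e he K _ _ _ _ s₀ hs W hW N hN hex hrec htr h4
  classical
  by_cases hpl : ∃ (k : Fin 3) (N' : ℕ), (∀ t, N' ≤ t → W.j t ≠ k ∧ W.b t k = 0) ∧ 1 ≤ (W.st N').r k
  · obtain ⟨k, N', hP, hr⟩ := hpl
    exact PlanarCut.noPlanarTails hs W k N' hP hr hrec htr
  · push Not at hpl
    exact h p hp e he K s₀ hs W hW N hN hex hrec htr h4 fun k N' hP => by have := hpl k N' hP; omega

/-- **EXACT**: the shade-`≥ 4` residual IS its non-planar part. [new] [folklore] -/
theorem four_iff_nonPlanarFour : NoJointTailsFromFourDeep ↔ NoNonPlanarJointTailsFromFourDeep :=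
  ⟨nonPlanarFour_of_four, four_of_nonPlanarFour⟩

/-- **EXACT, THE COMBINED BOOKING of the joint residual after lens-3 g17 and lens-5 g18 rev 1 (PROVED,
hypothesis-free)**: `ExitLaw.NoRepeatTranslationRecurrentExcessPlateauxDeep ↔ NoNonPlanarJointTailsFromFourDeep`.
[new] [folklore] -/
theorem joint_iff_nonPlanarFour :
    ExitLaw.NoRepeatTranslationRecurrentExcessPlateauxDeep ↔ NoNonPlanarJointTailsFromFourDeep :=
  joint_iff_four.trans four_iff_nonPlanarFour

/-- **EXACT, from lens-5's side**: the tree's non-planar residual IS the conjunction class. [new] [folklore] -/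
theorem nonPlanar_iff_nonPlanarFour :
    PlanarCut.NoNonPlanarRepeatTranslationRecurrentExcessPlateauxDeep ↔ NoNonPlanarJointTailsFromFourDeep :=
  PlanarCut.joint_iff_nonPlanar.symm.trans joint_iff_nonPlanarFour

/-- **KERNEL BY NAME (aside 31770)** from the conjunction class. [new] [folklore] -/
theorem defectWalksDeep_of_nonPlanarFour (hA : NoFreePointTailsDeep) (hR : NoNonPlanarJointTailsFromFourDeep) :
    MaxContactCut.DefectWalksDeep :=
  defectWalksDeep_of_four hA (four_of_nonPlanarFour hR)

/-- **THE EXACT CUT OF 31770 down to the conjunction class (PROVED, hypothesis-free).** [new] [folklore] -/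
theorem defectWalksDeep_iff_nonPlanarFour :
    MaxContactCut.DefectWalksDeep ↔ NoFreePointTailsDeep ∧ NoNonPlanarJointTailsFromFourDeep := by
  rw [defectWalksDeep_iff_four, four_iff_nonPlanarFour]

/-- Necessity of the conjunction class for 31770. [folklore] -/
theorem nonPlanarFour_of_defectWalksDeep (h : MaxContactCut.DefectWalksDeep) : NoNonPlanarJointTailsFromFourDeep :=
  (defectWalksDeep_iff_nonPlanarFour.mp h).2

end WithLens5

end Summit.ResolutionOfSingularities.ResolutionOfSingularities.Theorems.TightCut
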